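import Mathlib
import HarnessLib
import Summits.ResolutionOfSingularities.ResolutionOfSingularities.Theorems.WildQuotientsWildQuotientResolutionBlowupExitBasicOpenSections
import Summits.ResolutionOfSingularities.ResolutionOfSingularities.Theorems.WildQuotientsWildQuotientResolutionConductorOneFrameNormElt
import Summits.ResolutionOfSingularities.ResolutionOfSingularities.Theorems.WildQuotientsWildQuotientResolutionConductorOneFrameDict
import Summits.ResolutionOfSingularities.ResolutionOfSingularities.Theorems.WildQuotientsWildQuotientResolutionConductorOneChartSigma

/-!
# S2 brick F3c-6 — the FRAME of the conductor-𝟙 core: BOOLEAN-POINT SEPARATION — the zero locus in `O_I` of the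
# pulled-back chart coordinates misses every other piece `O_{I'}`

(crux stmt-ResolutionOfSingularities-15640 `WildQuotients.WildQuotientResolution`, line `Sketch`; chain w45c post-V5
programme S2, lead-1 F8 SIG `L/res-L1-w45c-lead-1/stubs/ConductorOneF8Sig.lean` d7f6f5f4537369e2 (last clause of
`FrameBrick`: `I ≠ I' → Disjoint (O I') (O_I.ι '' zeroLocus (e.symm '' range chartX))`); res-L1-w45c-plan-1 NO
OBJECTION 2026-08-27T19:44:04Z. [OURS · L1 W4.5c] — NOT a statement of any manuscript; replaces the role of no printed
item; AI-produced, weaker than expert review. Def-free. Prover res-D-pv-033.)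

Geometry: the zero locus of `s, c_l, e_l` in `O_I` is the boolean point `Q_I = [𝟙_I] ∈ E ≅ ℙ^{n−1}` (`t_l = 1` on `I`,
`t_l = 0` off `I`), and `Q_I ∈ O_{I'}` forces `I' ⊆ I ⊆ I'`. Algebra (this file): read a point `x ∈ O_I` as a prime
`𝔮ₓ` of `(Aₙ[𝔪t])_{(N_I)}` (the point clause of the seam, `…FrameSeamData`), transport to the prime
`𝔮 = A_*𝔮ₓ` of `M_I`; the zero-locus condition says `chartX l ∈ 𝔮` for all `l`; membership `x ∈ D₊(u_l t)` resp.
`x ∈ D₊((u_{i'} − u_l)t)` says `ρ_l ∉ 𝔮` resp. `ρ_{i'} − ρ_l ∉ 𝔮` where `β u_l = s·ρ_l` (`away_theta_mul_base`,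
`beta_pieceRad_eq`: `A(θ_{rt})·β(W_I) = β(r)^D`, `β(W_I) = s^D·unit`); and `ρ_l ∈ (chartX)` off `I`,
`ρ_l ≡ 1 mod (chartX)` on `I` — contradiction for `I ≠ I'` (`pieces_separated`).
-/

-- single-problem summit: the doubled namespace component `ResolutionOfSingularities` is forced
set_option linter.dupNamespace false

noncomputable section

open CategoryTheory AlgebraicGeometry TopologicalSpace MvPolynomial Polynomial HomogeneousLocalization
open Literature.AlgebraicGeometry.Resolution

namespace Summit.ResolutionOfSingularities.ResolutionOfSingularities.Theorems.WildQuotientResolution.ConductorOne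

variable (k : Type) [Field k] (p n : ℕ) [Fact p.Prime] [CharP k p] (i : Fin n) (I : Finset (Fin n))

/-- the Rees generator `uₗ t` -/
local notation3 (prettyPrint := false) "uT" l =>
  reesT (I := Ideal.span (Set.range (coreU k p n))) (coreU k p n l)
    (Ideal.mem_span_range_self (f := coreU k p n) (x := l))
/-- the Rees element `(uᵢ − uₗ) t` -/
local notation3 (prettyPrint := false) "dT" i:max l:max =>
  reesT (I := Ideal.span (Set.range (coreU k p n))) (coreU k p n i - coreU k p n l)
    (Ideal.sub_mem _ (Ideal.mem_span_range_self (f := coreU k p n) (x := i))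
      (Ideal.mem_span_range_self (f := coreU k p n) (x := l)))
/-- the inverse `w_l = (1 − u_l^{p−1})⁻¹` in `Aₙ` -/
local notation3 (prettyPrint := false) "cw" l => (((isUnit_coreFactor k p n l).unit⁻¹ : (CoreRing k p n)ˣ) :
  CoreRing k p n)
/-- the norm radicand `N_{il}` -/
local notation3 (prettyPrint := false) "nD" i:max l:max =>
  ((coreU k p n i - coreU k p n l) ^ p * ((cw i) * (cw l)))
/-- the piece radicand `W_{i,I}` -/
local notation3 (prettyPrint := false) "pieceRad" i:max I:max =>
  (coreT k p n i * (∏ l ∈ Finset.erase I i, coreT k p n l) * (∏ l ∈ Finset.univ \ I, (nD i l)))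
/-- the norm factor `(u_l t)^p · w_l` -/
local notation3 (prettyPrint := false) "nT" l =>
  ((uT l) ^ p * algebraMap (CoreRing k p n) (reesAlgebra (Ideal.span (Set.range (coreU k p n))))
    (((isUnit_coreFactor k p n l).unit⁻¹ : (CoreRing k p n)ˣ) : CoreRing k p n))
/-- the norm factor `((uᵢ−u_l) t)^p · wᵢ w_l` -/
local notation3 (prettyPrint := false) "nDT" i:max l:max =>
  ((dT i l) ^ p * algebraMap (CoreRing k p n) (reesAlgebra (Ideal.span (Set.range (coreU k p n))))
    ((((isUnit_coreFactor k p n i).unit⁻¹ * (isUnit_coreFactor k p n l).unit⁻¹ : (CoreRing k p n)ˣ)) :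
      CoreRing k p n))
/-- the norm element `N_{i,I}` -/
local notation3 (prettyPrint := false) "normElt" i:max I:max =>
  ((nT i) * (∏ l ∈ Finset.erase I i, (nT l)) * (∏ l ∈ Finset.univ \ I, (nDT i l)))
/-- the piece element of F3b -/
local notation3 (prettyPrint := false) "pieceElt" i:max I:max =>
  (uT i) * (∏ l ∈ Finset.erase I i, (uT l)) * (∏ l ∈ Finset.univ \ I, (dT i l))
/-- the inverse `t_l = Ring.inverse (1 + X_l)` in `M_I` -/
local notation3 (prettyPrint := false) "tI" l => Ring.inverse (1 + chartX k p n i I l)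

/-! ## Algebra in `(Aₙ[𝔪t])_{(N_{i,I})}` and its image in `M_I` -/

-- literal norm element in the statements: head-room
set_option maxHeartbeats 1600000 in
omit [Fact p.Prime] [CharP k p] in
/-- `θ_{rt} · (W_{i,I}/1) = r^D/1` in `(Aₙ[𝔪t])_{(N_{i,I})}` for `r ∈ 𝔪` (`θ_{rt} = (rt)^D/N_{i,I}`). [OURS · L1 W4.5c] -/
theorem away_theta_mul_base (r : CoreRing k p n) (hr : r ∈ Ideal.span (Set.range (coreU k p n))) :
    Away.isLocalizationElem (𝒜 := reesGrading (Ideal.span (Set.range (coreU k p n)))) (normElt_mem k p n i I)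
        (reesT_mem r hr) *
      ((fromZeroRingHom (reesGrading (Ideal.span (Set.range (coreU k p n)))) (.powers (normElt i I))).comp
        (reesGrading.zeroRingHom (Ideal.span (Set.range (coreU k p n))))) (pieceRad i I) =
    ((fromZeroRingHom (reesGrading (Ideal.span (Set.range (coreU k p n)))) (.powers (normElt i I))).comp
        (reesGrading.zeroRingHom (Ideal.span (Set.range (coreU k p n)))))
      (r ^ (p + (I.erase i).card * p + (Finset.univ \ I).card * p)) := by
  set D := p + (I.erase i).card * p + (Finset.univ \ I).card * p with hD
  have hx : reesT r hr ^ D ∈ reesGrading (Ideal.span (Set.range (coreU k p n))) (1 • D) := by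
    simpa using SetLike.pow_mem_graded D (reesT_mem r hr)
  have hxr : ((reesT r hr ^ D : reesAlgebra (Ideal.span (Set.range (coreU k p n)))) : (CoreRing k p n)[X]) =
      Polynomial.monomial (1 * D) (r ^ D) := by
    rw [Subalgebra.coe_pow, coe_reesT, Polynomial.monomial_pow]
  have h := BlowupExit.awayMk_mul_base_pow (normElt i I) (normElt_mem k p n i I) (pieceRad i I)
    (coe_normElt k p n i I) 1 (reesT r hr ^ D) hx (r ^ D) hxr
  have e1 : ∀ z : HomogeneousLocalization.Away (reesGrading (Ideal.span (Set.range (coreU k p n)))) (normElt i I),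
      z ^ 1 = z := fun z => pow_one z
  rw [e1] at h
  exact h

/-- **`β(W_{i,I}) = s^D · E` with `E` a unit** (`β` the chart map with its `Ring.inverse` forms). [OURS · L1 W4.5c] -/
theorem beta_pieceRad_eq (hi : i ∈ I) (β : CoreRing k p n →ₐ[k] ChartRing k p n i I)
    (hβi : β (coreU k p n i) = chartX k p n i I i)
    (hβI : ∀ l ∈ I.erase i, β (coreU k p n l) = chartX k p n i I i * (tI l))
    (hβO : ∀ l ∉ I, β (coreU k p n l) = chartX k p n i I i * chartX k p n i I l * (tI l)) :
    ∃ E : ChartRing k p n i I, IsUnit E ∧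
      β (pieceRad i I) = chartX k p n i I i ^ (p + (I.erase i).card * p + (Finset.univ \ I).card * p) * E := by
  have htIu : ∀ l, IsUnit (tI l) := fun l =>
    IsUnit.of_mul_eq_one _ (by rw [mul_comm]; exact one_add_chartX_mul_tInv k p n i I hi l)
  have hcwu : ∀ l, IsUnit (β (cw l)) := fun l => (Units.isUnit _).map β
  refine ⟨β (cw i) * (∏ l ∈ I.erase i, ((tI l) ^ p * β (cw l))) *
    (∏ l ∈ Finset.univ \ I, ((tI l) ^ p * (β (cw i) * β (cw l)))), ?_, ?_⟩
  · exact ((hcwu i).mul (IsUnit.prod_iff.mpr fun l _ => ((htIu l).pow p).mul (hcwu l))).mul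
      (IsUnit.prod_iff.mpr fun l _ => ((htIu l).pow p).mul ((hcwu i).mul (hcwu l)))
  · have e1 : ∏ l ∈ I.erase i, β (coreT k p n l) =
        (chartX k p n i I i ^ p) ^ (I.erase i).card * ∏ l ∈ I.erase i, ((tI l) ^ p * β (cw l)) := by
      rw [Finset.prod_congr rfl fun l hl => beta_coreT_of_mem_erase k p n i I β hβI l hl, Finset.prod_mul_distrib,
        Finset.prod_const]
    have e2 : ∏ l ∈ Finset.univ \ I, β (nD i l) =
        (chartX k p n i I i ^ p) ^ (Finset.univ \ I).card *
          ∏ l ∈ Finset.univ \ I, ((tI l) ^ p * (β (cw i) * β (cw l))) := by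
      rw [Finset.prod_congr rfl fun l hl =>
        beta_normDiff k p n i I hi β hβi hβO l (Finset.mem_sdiff.mp hl).2, Finset.prod_mul_distrib,
        Finset.prod_const]
    rw [map_mul, map_mul, beta_coreT_self k p n i I β hβi, map_prod, map_prod, e1, e2]
    ring

set_option maxHeartbeats 1600000 in
omit [Fact p.Prime] [CharP k p] in
/-- **`A(θ_{rt}) · E · s^D = (β r)^D`**: the image of `θ_{rt}` under the algebra isomorphism `A` of F3c-4b.
[OURS · L1 W4.5c] -/
theorem A_theta_mul (β : CoreRing k p n →ₐ[k] ChartRing k p n i I)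
    (A : HomogeneousLocalization.Away (reesGrading (Ideal.span (Set.range (coreU k p n)))) (normElt i I) ≃+*
      ChartRing k p n i I)
    (hA : ∀ r : CoreRing k p n,
      A (((fromZeroRingHom (reesGrading (Ideal.span (Set.range (coreU k p n)))) (.powers (normElt i I))).comp
        (reesGrading.zeroRingHom (Ideal.span (Set.range (coreU k p n))))) r) = β r)
    (E : ChartRing k p n i I)
    (hE : β (pieceRad i I) = chartX k p n i I i ^ (p + (I.erase i).card * p + (Finset.univ \ I).card * p) * E)
    (r : CoreRing k p n) (hr : r ∈ Ideal.span (Set.range (coreU k p n))) :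
    A (Away.isLocalizationElem (𝒜 := reesGrading (Ideal.span (Set.range (coreU k p n)))) (normElt_mem k p n i I)
        (reesT_mem r hr)) * E * chartX k p n i I i ^ (p + (I.erase i).card * p + (Finset.univ \ I).card * p) =
      β r ^ (p + (I.erase i).card * p + (Finset.univ \ I).card * p) := by
  have h := congrArg A (away_theta_mul_base k p n i I r hr)
  rw [map_mul, hA, hA, map_pow, hE] at h
  linear_combination h

/-! ## The separation -/

set_option maxHeartbeats 1600000 in
omit [CharP k p] in
/-- **Prime membership transfer**: if `θ_{rt} ∉ 𝔮` (a prime of `(Aₙ[𝔪t])_{(N)}`) and `β r = s · ρ`, then `ρ` is not in the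
prime `A_* 𝔮` of `M_I`. [OURS · L1 W4.5c] -/
theorem rho_not_mem_of_theta_not_mem (β : CoreRing k p n →ₐ[k] ChartRing k p n i I)
    (A : HomogeneousLocalization.Away (reesGrading (Ideal.span (Set.range (coreU k p n)))) (normElt i I) ≃+*
      ChartRing k p n i I)
    (hA : ∀ r : CoreRing k p n,
      A (((fromZeroRingHom (reesGrading (Ideal.span (Set.range (coreU k p n)))) (.powers (normElt i I))).comp
        (reesGrading.zeroRingHom (Ideal.span (Set.range (coreU k p n))))) r) = β r)
    (E : ChartRing k p n i I) (hEu : IsUnit E)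
    (hE : β (pieceRad i I) = chartX k p n i I i ^ (p + (I.erase i).card * p + (Finset.univ \ I).card * p) * E)
    (𝔮 : PrimeSpectrum (HomogeneousLocalization.Away (reesGrading (Ideal.span (Set.range (coreU k p n))))
      (normElt i I)))
    (r : CoreRing k p n) (hr : r ∈ Ideal.span (Set.range (coreU k p n))) (ρ : ChartRing k p n i I)
    (hρ : β r = chartX k p n i I i * ρ)
    (hθ : Away.isLocalizationElem (𝒜 := reesGrading (Ideal.span (Set.range (coreU k p n)))) (normElt_mem k p n i I)
      (reesT_mem r hr) ∉ 𝔮.asIdeal) :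
    ρ ∉ (𝔮.asIdeal.comap (A.symm : ChartRing k p n i I →+* _)) := by
  haveI : IsDomain (ChartRing k p n i I) := chartRing_isDomain k p n i I
  have hs0 : chartX k p n i I i ≠ 0 := fun h =>
    X_ne_zero i (chart_algebraMap_injective k p n i I (h.trans (map_zero _).symm))
  set D := p + (I.erase i).card * p + (Finset.univ \ I).card * p with hD
  have hD0 : D ≠ 0 := by have := (Fact.out : p.Prime).pos; omega
  have hprime : (𝔮.asIdeal.comap (A.symm : ChartRing k p n i I →+* _)).IsPrime := Ideal.comap_isPrime _ _
  -- `A θ · E = ρ^D`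
  have key := A_theta_mul k p n i I β A hA E hE r hr
  rw [hρ, mul_pow] at key
  have key' : A (Away.isLocalizationElem (𝒜 := reesGrading (Ideal.span (Set.range (coreU k p n))))
      (normElt_mem k p n i I) (reesT_mem r hr)) * E = ρ ^ D := by
    refine mul_right_cancel₀ (pow_ne_zero D hs0) ?_
    rw [key]; ring
  intro hmem
  have h1 : ρ ^ D ∈ 𝔮.asIdeal.comap (A.symm : ChartRing k p n i I →+* _) := Ideal.pow_mem_of_mem _ hmem D (Nat.pos_of_ne_zero hD0)
  rw [← key'] at h1
  rcases hprime.mem_or_mem h1 with h2 | h2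
  · apply hθ
    have h3 : A.symm (A (Away.isLocalizationElem (𝒜 := reesGrading (Ideal.span (Set.range (coreU k p n))))
        (normElt_mem k p n i I) (reesT_mem r hr))) ∈ 𝔮.asIdeal := h2
    rwa [A.symm_apply_apply] at h3
  · exact hprime.ne_top (Ideal.eq_top_of_isUnit_mem _ h2 hEu)

set_option maxHeartbeats 4000000 in
/-- **BOOLEAN-POINT SEPARATION** (last clause of lead-1's `FrameBrick`): for `I ≠ I'`, the zero locus in `O_I` of the
pulled-back chart coordinates `e⁻¹(X_l)` does not meet `O_{I'}`. Hypotheses = the seam data of `O_I`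
(`exists_pieceSeamData`): `β` with its `Ring.inverse` forms, `Ω`, `A` with `A(r/1) = β r`, and the point clause.
[OURS · L1 W4.5c] -/
theorem pieces_separated (hI : I.Nonempty) (hi : i = I.min' hI) (I' : Finset (Fin n)) (hI' : I'.Nonempty)
    (hne : I ≠ I') {Y : Scheme.{0}} (q : Spec (CommRingCat.of (CoreRing k p n)) ⟶ Y)
    (O O' : (affineBlowup (Ideal.span (Set.range (coreU k p n)))).Opens)
    (_hOs : O = Proj.basicOpen (reesGrading (Ideal.span (Set.range (coreU k p n)))) (normElt i I))
    (hO's : O' = Proj.basicOpen (reesGrading (Ideal.span (Set.range (coreU k p n)))) (normElt (I'.min' hI') I'))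
    (β : CoreRing k p n →ₐ[k] ChartRing k p n i I)
    (hβi : β (coreU k p n i) = chartX k p n i I i)
    (hβI : ∀ l ∈ I.erase i, β (coreU k p n l) = chartX k p n i I i * (tI l))
    (hβO : ∀ l ∉ I, β (coreU k p n l) = chartX k p n i I i * chartX k p n i I l * (tI l))
    (Ω : HomogeneousLocalization.Away (reesGrading (Ideal.span (Set.range (coreU k p n)))) (normElt i I) ≃+*
      Γ((O : Scheme.{0}), (O.ι ≫ affineBlowup.π (Ideal.span (Set.range (coreU k p n))) ≫ q) ⁻¹ᵁ ⊤))
    (A : HomogeneousLocalization.Away (reesGrading (Ideal.span (Set.range (coreU k p n)))) (normElt i I) ≃+*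
      ChartRing k p n i I)
    (hA : ∀ r : CoreRing k p n,
      A (((fromZeroRingHom (reesGrading (Ideal.span (Set.range (coreU k p n)))) (.powers (normElt i I))).comp
        (reesGrading.zeroRingHom (Ideal.span (Set.range (coreU k p n))))) r) = β r)
    (hpts : ∀ x : (O : Scheme.{0}), ∃ 𝔮 : PrimeSpectrum
        (HomogeneousLocalization.Away (reesGrading (Ideal.span (Set.range (coreU k p n)))) (normElt i I)),
      (∀ y, x ∈ (O : Scheme.{0}).basicOpen (Ω y) ↔ y ∉ 𝔮.asIdeal) ∧
      (∀ (g' : reesAlgebra (Ideal.span (Set.range (coreU k p n)))) (m' : ℕ)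
        (hg' : g' ∈ reesGrading (Ideal.span (Set.range (coreU k p n))) m') (_ : 0 < m'),
        O.ι.base x ∈ Proj.basicOpen (reesGrading (Ideal.span (Set.range (coreU k p n)))) g' ↔
          Away.isLocalizationElem (normElt_mem k p n i I) hg' ∉ 𝔮.asIdeal)) :
    Disjoint (O' : Set (affineBlowup (Ideal.span (Set.range (coreU k p n)))))
      (O.ι.base '' ((O : Scheme.{0}).zeroLocus
        ((Ω.symm.trans A).symm '' Set.range (chartX k p n i I)))) := by
  have hiI : i ∈ I := by rw [hi]; exact Finset.min'_mem I hI
  set i' := I'.min' hI' with hi'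
  have hi'I' : i' ∈ I' := Finset.min'_mem I' hI'
  obtain ⟨E, hEu, hE⟩ := beta_pieceRad_eq k p n i I hiI β hβi hβI hβO
  -- the values `ρ_l` with `β u_l = s ρ_l`
  let ρ : Fin n → ChartRing k p n i I := fun l =>
    if l = i then 1 else if l ∈ I then (tI l) else chartX k p n i I l * (tI l)
  have hρ : ∀ l, β (coreU k p n l) = chartX k p n i I i * ρ l := by
    intro l
    by_cases hli : l = i
    · simp only [ρ, hli, if_true, mul_one]; exact hβi
    by_cases hlI : l ∈ I
    · simp only [ρ, hli, hlI, if_false, if_true]; exact hβI l (Finset.mem_erase.mpr ⟨hli, hlI⟩)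
    · simp only [ρ, hli, hlI, if_false]; rw [hβO l hlI, mul_assoc]
  -- `ρ_l ∈ J` off `I`, `ρ_l − 1 ∈ J` on `I`, for `J = (chartX)`
  set J : Ideal (ChartRing k p n i I) := Ideal.span (Set.range (chartX k p n i I)) with hJ
  have hXJ : ∀ l, chartX k p n i I l ∈ J := fun l => Ideal.subset_span ⟨l, rfl⟩
  have hρO : ∀ l ∉ I, ρ l ∈ J := by
    intro l hlI
    have hli : l ≠ i := fun h => hlI (h ▸ hiI)
    simp only [ρ, hli, hlI, if_false]
    exact J.mul_mem_right _ (hXJ l)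
  have hρI : ∀ l ∈ I, ρ l - 1 ∈ J := by
    intro l hlI
    by_cases hli : l = i
    · simp only [ρ, hli, if_true, sub_self]; exact J.zero_mem
    · simp only [ρ, hli, hlI, if_false, if_true]
      have h1 := one_add_chartX_mul_tInv k p n i I hiI l
      have e : (tI l) - 1 = -(chartX k p n i I l * (tI l)) := by linear_combination h1
      rw [e]; exact J.neg_mem (J.mul_mem_right _ (hXJ l))
  -- disjointness
  rw [Set.disjoint_left]
  rintro v hv' ⟨x, hx, rfl⟩
  rw [Scheme.mem_zeroLocus_iff] at hx
  obtain ⟨𝔮, hqΩ, hqD⟩ := hpts x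
  -- the zero-locus condition: `chartX l ∈ 𝔮C`
  have hqX : ∀ l, chartX k p n i I l ∈ 𝔮.asIdeal.comap (A.symm : ChartRing k p n i I →+* _) := by
    intro l
    have h := hx ((Ω.symm.trans A).symm (chartX k p n i I l)) ⟨_, ⟨l, rfl⟩, rfl⟩
    rw [RingEquiv.symm_trans_apply, RingEquiv.symm_symm, hqΩ, not_not] at h
    exact h
  have hJq : J ≤ 𝔮.asIdeal.comap (A.symm : ChartRing k p n i I →+* _) := Ideal.span_le.mpr (by
    rintro _ ⟨l, rfl⟩; exact hqX l)
  -- membership in `O_{I'}` factor by factor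
  rw [hO's] at hv'
  have hv'' : O.ι.base x ∈ Proj.basicOpen (reesGrading (Ideal.span (Set.range (coreU k p n)))) (normElt i' I') := hv'
  rw [basicOpen_normElt_eq, piece_eq_inf, Opens.mem_inf, Opens.mem_inf, mem_finset_inf_opens,
    mem_finset_inf_opens] at hv''
  obtain ⟨⟨hvi', hvT⟩, hvD⟩ := hv''
  have hnotI' : ∀ l ∈ I', ρ l ∉ 𝔮.asIdeal.comap (A.symm : ChartRing k p n i I →+* _) := by
    intro l hl
    have hmem : O.ι.base x ∈ Proj.basicOpen (reesGrading (Ideal.span (Set.range (coreU k p n)))) (uT l) := by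
      by_cases hli' : l = i'
      · rw [hli']; exact hvi'
      · exact hvT l (Finset.mem_erase.mpr ⟨hli', hl⟩)
    have hθ := (hqD (uT l) 1 (reesT_mem _ _) one_pos).mp hmem
    exact rho_not_mem_of_theta_not_mem k p n i I β A hA E hEu hE 𝔮 _ _ (ρ l) (hρ l) hθ
  have hnotO' : ∀ l ∉ I', ρ i' - ρ l ∉ 𝔮.asIdeal.comap (A.symm : ChartRing k p n i I →+* _) := by
    intro l hl
    have hmem : O.ι.base x ∈ Proj.basicOpen (reesGrading (Ideal.span (Set.range (coreU k p n)))) (dT i' l) :=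
      hvD l (Finset.mem_sdiff.mpr ⟨Finset.mem_univ l, hl⟩)
    have hθ := (hqD (dT i' l) 1 (reesT_mem _ _) one_pos).mp hmem
    refine rho_not_mem_of_theta_not_mem k p n i I β A hA E hEu hE 𝔮 _ _ (ρ i' - ρ l) ?_ hθ
    rw [map_sub, hρ, hρ, mul_sub]
  -- the boolean case analysis
  by_cases hsub : I' ⊆ I
  · -- `I' ⊊ I`: pick `l ∈ I ∖ I'`
    have hss : I' ⊂ I := lt_of_le_of_ne hsub (Ne.symm hne)
    obtain ⟨l, hlI, hlI'⟩ := Finset.exists_of_ssubset hss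
    apply hnotO' l hlI'
    have e : ρ i' - ρ l = (ρ i' - 1) - (ρ l - 1) := by ring
    rw [e]
    exact hJq (J.sub_mem (hρI i' (hsub hi'I')) (hρI l hlI))
  · obtain ⟨l, hlI', hlI⟩ := Finset.not_subset.mp hsub
    exact hnotI' l hlI' (hJq (hρO l hlI))

end Summit.ResolutionOfSingularities.ResolutionOfSingularities.Theorems.WildQuotientResolution.ConductorOne

end
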